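import Summits.Ventures.YMGap.FlowData.RectTubeVacuumSector
import Summits.Ventures.YMGap.FlowData.RectTubeTransferPositivity
import HarnessLib

/-!
# Venture YMGap, track Y3 FLOW-DATA — the JENSEN–FEYNMAN SANDWICH for a multiplicatively reweighted tube kernel:
# `∫ (−2g) Ω_B² ≤ log ‖T‖ − log ‖B‖ ≤ ∫ (−2g) Ω_T²` when `B` has kernel `e^{g(a)} K(a,b) e^{g(b)}` (theorems only)

HONEST FRAMING: venture file of the cell `pub-ymgap` (QuantumFields programme), track Y3 (FLOW-DATA); a TOOLS file for the
rectangular tube operator `T = rectTubeTransferOperator ρ J Ls` (kernel `K = rectSliceKernel ρ J J`).  Finite spatial torus,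
compact second-countable `G`; no number, no row, nothing about `L → ∞`, the continuum or a mass gap.

If `B` is the operator with the REWEIGHTED kernel `e^{g(a)} K(a,b) e^{g(b)}` (`g` continuous; e.g. a change of the magnetic
weights of every slice — the magnetically twisted operator of `RectTubeMagneticTwist.lean` is `g = (J/2)(magTw_ζ − mag)`), then
with `Ω_T`, `Ω_B` unit top eigenvectors of `T`, `B` (`J ≥ 0`, so `T ⪰ 0` by Lüscher positivity and hence `B ⪰ 0`):

  `∫ (−2 g) Ω_B² dμ ≤ log ‖T‖ − log ‖B‖ ≤ ∫ (−2 g) Ω_T² dμ`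

(Gibbs–Bogoliubov / Peierls type: the variational principle through the other operator's vacuum, then Jensen — here the
elementary `log t ≤ t − 1`).  Both bounds are first-order exact in `g`.

* abstract Hilbert space: `real_inner_apply_le_norm_mul_sq` (`⟪ψ,Aψ⟫ ≤ ‖A‖‖ψ‖²`), **`norm_mul_inner_sq_le_inner_apply`**
  (`A ⪰ 0` self-adjoint, `AΩ = ‖A‖Ω`, `‖Ω‖ = 1` ⇒ `‖A‖⟪Ω,v⟫² ≤ ⟪v,Av⟫`);
* abstract kernels on a finite measure space: `inner_reweighted_eq` (`⟪φ,Bψ⟫ = ⟪wφ, A(wψ)⟫`), `inner_reweighted_self_nonneg`,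
  **`norm_mul_sq_integral_le_norm_reweighted`** (`‖A‖ (∫ w Ω²)² ≤ ‖B‖`), `integral_mul_sq_sub_log_le` (Jensen for `log`, elementary),
  **`log_norm_sub_log_norm_reweighted_le`** (`log ‖A‖ − log ‖B‖ ≤ ∫ (−2g) Ω²`);
* the tube: **`rectTube_log_norm_sub_reweighted_le`**, **`rectTube_log_norm_sub_reweighted_ge`** (the sandwich above).

References: M. Reed, B. Simon IV (1978) §XIII.12 [cite: ReedSimonIV1978, §XIII.12]; M. Lüscher, Commun. Math. Phys. 54 (1977) 283
[cite: Luscher1977]; K. Osterwalder, E. Seiler, Ann. Phys. 110 (1978) 440 §3 [cite: OsterwalderSeilerAnnPhys1978, §3].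
-/

noncomputable section

open scoped BigOperators ENNReal RealInnerProductSpace
open MeasureTheory Filter Function
open Literature.MathematicalPhysics.QuantumFieldTheory Literature.Analysis.OperatorTheory
open Literature.MathematicalPhysics.QuantumLattice (RectTorusSite)

namespace Summit.Ventures.YMGap.FlowData

/-! ### Abstract Hilbert space -/

section Hilbert

variable {H : Type*} [NormedAddCommGroup H] [InnerProductSpace ℝ H] [CompleteSpace H]

omit [CompleteSpace H] in
/-- `⟪ψ, A ψ⟫ ≤ ‖A‖ ‖ψ‖²`. [folklore] -/
theorem real_inner_apply_le_norm_mul_sq (A : H →L[ℝ] H) (ψ : H) : ⟪ψ, A ψ⟫ ≤ ‖A‖ * ‖ψ‖ ^ 2 := by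
  calc ⟪ψ, A ψ⟫ ≤ ‖ψ‖ * ‖A ψ‖ := real_inner_le_norm _ _
    _ ≤ ‖ψ‖ * (‖A‖ * ‖ψ‖) := mul_le_mul_of_nonneg_left (A.le_opNorm ψ) (norm_nonneg _)
    _ = ‖A‖ * ‖ψ‖ ^ 2 := by ring

/-- **Variational lower bound through a top eigenvector**: for a positive self-adjoint `A` with `A Ω = ‖A‖ Ω`, `‖Ω‖ = 1`,
every `v` has `‖A‖ ⟪Ω, v⟫² ≤ ⟪v, A v⟫` (split `v = ⟪Ω,v⟫Ω + χ`, `χ ⊥ Ω`, cross terms vanish, `⟪χ,Aχ⟫ ≥ 0`).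
[cite: ReedSimonIV1978, §XIII.12] -/
theorem norm_mul_inner_sq_le_inner_apply (A : H →L[ℝ] H) (hA : IsSelfAdjoint A) (hpos : ∀ x : H, 0 ≤ ⟪x, A x⟫)
    {Ω : H} (h1 : ‖Ω‖ = 1) (heig : A Ω = ‖A‖ • Ω) (v : H) : ‖A‖ * ⟪Ω, v⟫ ^ 2 ≤ ⟪v, A v⟫ := by
  set α : ℝ := ⟪Ω, v⟫ with hα
  set χ : H := v - α • Ω with hχ
  have hv : v = α • Ω + χ := by rw [hχ, add_sub_cancel]
  have hΩΩ : ⟪Ω, Ω⟫ = 1 := by rw [real_inner_self_eq_norm_sq, h1, one_pow]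
  have hΩχ : ⟪Ω, χ⟫ = 0 := by rw [hχ, inner_sub_right, inner_smul_right, hΩΩ, mul_one, hα, sub_self]
  have hsym : ∀ x y : H, ⟪A x, y⟫ = ⟪x, A y⟫ := fun x y => hA.isSymmetric x y
  have hAχΩ : ⟪χ, A Ω⟫ = 0 := by rw [heig, inner_smul_right, real_inner_comm, hΩχ, mul_zero]
  have hΩAχ : ⟪Ω, A χ⟫ = 0 := by rw [← hsym, heig, inner_smul_left, hΩχ]; simp
  have hΩAΩ : ⟪Ω, A Ω⟫ = ‖A‖ := by rw [heig, inner_smul_right, hΩΩ, mul_one]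
  have hexp : ⟪v, A v⟫ = α ^ 2 * ‖A‖ + ⟪χ, A χ⟫ := by
    rw [hv, map_add, map_smul, inner_add_left, inner_add_right, inner_add_right, inner_smul_left, inner_smul_left,
      inner_smul_right, inner_smul_right, hΩAΩ, hΩAχ, hAχΩ]
    simp only [conj_trivial, mul_zero, add_zero]
    ring
  rw [hexp]
  nlinarith [hpos χ]

end Hilbert

/-! ### Abstract reweighted kernels on a finite measure space -/

section Reweight

variable {X : Type*} [MeasurableSpace X] {μ : Measure X}

/-- A bounded strongly measurable weight times an `L²` function is `L²`. [folklore] -/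
theorem memLp_two_weight_mul {w : X → ℝ} (hw : StronglyMeasurable w) {Cw : ℝ} (hCw : ∀ x, ‖w x‖ ≤ Cw) (φ : Lp ℝ 2 μ) :
    MemLp (fun x => w x * φ x) 2 μ := by
  refine MemLp.of_le_mul (g := (φ : X → ℝ)) (c := Cw) (Lp.memLp φ)
    (hw.aestronglyMeasurable.mul (Lp.aestronglyMeasurable φ)) (Eventually.of_forall fun x => ?_)
  rw [norm_mul]
  exact mul_le_mul_of_nonneg_right (hCw x) (norm_nonneg _)

variable {K : X → X → ℝ} {C : ℝ} {w : X → ℝ} {Cw : ℝ} {A B : Lp ℝ 2 μ →L[ℝ] Lp ℝ 2 μ}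

/-- **`⟪φ, B ψ⟫ = ⟪wφ, A (wψ)⟫`** when `B` has the reweighted kernel `w(x) K(x,y) w(y)`. [folklore] -/
theorem inner_reweighted_eq (hw : StronglyMeasurable w) (hCw : ∀ x, ‖w x‖ ≤ Cw)
    (hA : ∀ φ : Lp ℝ 2 μ, (A φ : X → ℝ) =ᵐ[μ] fun x => ∫ y, K x y * φ y ∂μ)
    (hB : ∀ φ : Lp ℝ 2 μ, (B φ : X → ℝ) =ᵐ[μ] fun x => ∫ y, (w x * K x y * w y) * φ y ∂μ) (φ ψ : Lp ℝ 2 μ) :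
    ⟪φ, B ψ⟫ = ⟪(memLp_two_weight_mul hw hCw φ).toLp _, A ((memLp_two_weight_mul hw hCw ψ).toLp _)⟫ := by
  rw [inner_eq_integral, inner_eq_integral]
  refine integral_congr_ae ?_
  filter_upwards [hB ψ, (memLp_two_weight_mul hw hCw φ).coeFn_toLp,
    hA ((memLp_two_weight_mul hw hCw ψ).toLp _)] with x hBx hφx hAx
  rw [hBx, hφx, hAx]
  have hin : ∫ y, K x y * ((memLp_two_weight_mul hw hCw ψ).toLp _ : Lp ℝ 2 μ) y ∂μ =
      ∫ y, K x y * (w y * ψ y) ∂μ := by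
    refine integral_congr_ae ?_
    filter_upwards [(memLp_two_weight_mul hw hCw ψ).coeFn_toLp] with y hy
    rw [hy]
  rw [hin]
  have h3 : ∫ y, (w x * K x y * w y) * ψ y ∂μ = w x * ∫ y, K x y * (w y * ψ y) ∂μ := by
    rw [← integral_const_mul]
    refine integral_congr_ae (Eventually.of_forall fun y => ?_)
    ring
  rw [h3]
  ring

/-- Positivity passes to the reweighted operator: `A ⪰ 0 ⇒ B ⪰ 0` (quadratic forms). [folklore] -/
theorem inner_reweighted_self_nonneg (hw : StronglyMeasurable w) (hCw : ∀ x, ‖w x‖ ≤ Cw)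
    (hA : ∀ φ : Lp ℝ 2 μ, (A φ : X → ℝ) =ᵐ[μ] fun x => ∫ y, K x y * φ y ∂μ)
    (hB : ∀ φ : Lp ℝ 2 μ, (B φ : X → ℝ) =ᵐ[μ] fun x => ∫ y, (w x * K x y * w y) * φ y ∂μ)
    (hApos : ∀ φ : Lp ℝ 2 μ, 0 ≤ ⟪φ, A φ⟫) (φ : Lp ℝ 2 μ) : 0 ≤ ⟪φ, B φ⟫ := by
  rw [inner_reweighted_eq hw hCw hA hB]
  exact hApos _

/-- **`‖A‖ (∫ w Ω²)² ≤ ‖B‖`**: the reweighted operator tested on the top eigenvector `Ω` of the positive self-adjoint `A`.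
[cite: ReedSimonIV1978, §XIII.12] -/
theorem norm_mul_sq_integral_le_norm_reweighted (hw : StronglyMeasurable w) (hCw : ∀ x, ‖w x‖ ≤ Cw)
    (hA : ∀ φ : Lp ℝ 2 μ, (A φ : X → ℝ) =ᵐ[μ] fun x => ∫ y, K x y * φ y ∂μ)
    (hB : ∀ φ : Lp ℝ 2 μ, (B φ : X → ℝ) =ᵐ[μ] fun x => ∫ y, (w x * K x y * w y) * φ y ∂μ)
    (hAsa : IsSelfAdjoint A) (hApos : ∀ φ : Lp ℝ 2 μ, 0 ≤ ⟪φ, A φ⟫) {Ω : Lp ℝ 2 μ} (h1 : ‖Ω‖ = 1)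
    (heig : A Ω = ‖A‖ • Ω) :
    ‖A‖ * (∫ x, w x * (Ω x * Ω x) ∂μ) ^ 2 ≤ ‖B‖ := by
  set v : Lp ℝ 2 μ := (memLp_two_weight_mul hw hCw Ω).toLp _ with hvdef
  have hΩv : ⟪Ω, v⟫ = ∫ x, w x * (Ω x * Ω x) ∂μ := by
    rw [inner_eq_integral]
    refine integral_congr_ae ?_
    filter_upwards [(memLp_two_weight_mul hw hCw Ω).coeFn_toLp] with x hx
    rw [hx]; ring
  calc ‖A‖ * (∫ x, w x * (Ω x * Ω x) ∂μ) ^ 2 = ‖A‖ * ⟪Ω, v⟫ ^ 2 := by rw [hΩv]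
    _ ≤ ⟪v, A v⟫ := norm_mul_inner_sq_le_inner_apply A hAsa hApos h1 heig v
    _ = ⟪Ω, B Ω⟫ := (inner_reweighted_eq hw hCw hA hB Ω Ω).symm
    _ ≤ ‖B‖ * ‖Ω‖ ^ 2 := real_inner_apply_le_norm_mul_sq B Ω
    _ = ‖B‖ := by rw [h1, one_pow, mul_one]

/-- **Jensen for `log` against a unit `L²` density, elementary form**: `∫ g Ω² ≤ log ∫ e^{g} Ω²` for bounded strongly
measurable `g` and `‖Ω‖ = 1` (`log t ≤ t − 1`). [folklore] -/
theorem integral_mul_sq_le_log_integral_exp_mul_sq {g : X → ℝ} (hg : StronglyMeasurable g) {Cg : ℝ} (hCg : ∀ x, ‖g x‖ ≤ Cg)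
    {Ω : Lp ℝ 2 μ} (h1 : ‖Ω‖ = 1) :
    ∫ x, g x * (Ω x * Ω x) ∂μ ≤ Real.log (∫ x, Real.exp (g x) * (Ω x * Ω x) ∂μ) := by
  have hΩ2 : Integrable (fun x => Ω x * Ω x) μ := integrable_mul Ω Ω
  have hΩ2one : ∫ x, Ω x * Ω x ∂μ = 1 := by
    rw [← inner_eq_integral, real_inner_self_eq_norm_sq, h1, one_pow]
  have hnn : ∀ x, 0 ≤ Ω x * Ω x := fun x => mul_self_nonneg _
  have hgi : Integrable (fun x => g x * (Ω x * Ω x)) μ :=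
    hΩ2.bdd_mul hg.aestronglyMeasurable (Eventually.of_forall fun x => hCg x)
  have hei : Integrable (fun x => Real.exp (g x) * (Ω x * Ω x)) μ :=
    hΩ2.bdd_mul (Real.continuous_exp.comp_stronglyMeasurable hg).aestronglyMeasurable
      (Eventually.of_forall fun x => by
        rw [Real.norm_eq_abs, abs_of_pos (Real.exp_pos _)]
        exact Real.exp_le_exp.2 ((le_abs_self _).trans ((Real.norm_eq_abs _).symm.le.trans (hCg x))))
  set m : ℝ := ∫ x, Real.exp (g x) * (Ω x * Ω x) ∂μ with hm
  -- `m ≥ e^{−Cg} > 0`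
  have hmpos : 0 < m := by
    have hle : ∫ x, Real.exp (-Cg) * (Ω x * Ω x) ∂μ ≤ m := by
      refine integral_mono (hΩ2.const_mul _) hei fun x => ?_
      refine mul_le_mul_of_nonneg_right (Real.exp_le_exp.2 ?_) (hnn x)
      have := hCg x; rw [Real.norm_eq_abs] at this; linarith [neg_abs_le (g x)]
    rw [integral_const_mul, hΩ2one, mul_one] at hle
    exact lt_of_lt_of_le (Real.exp_pos _) hle
  -- `∫ (g − log m) Ω² = ∫ log(e^g/m) Ω² ≤ ∫ (e^g/m − 1) Ω² = 0`
  have hkey : ∫ x, (g x - Real.log m) * (Ω x * Ω x) ∂μ ≤ ∫ x, (Real.exp (g x) / m - 1) * (Ω x * Ω x) ∂μ := by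
    refine integral_mono ?_ ?_ fun x => ?_
    · exact hgi.sub (hΩ2.const_mul _) |>.congr (Eventually.of_forall fun x => by simp only [Pi.sub_apply]; ring)
    · exact ((hei.div_const m).sub hΩ2) |>.congr (Eventually.of_forall fun x => by simp only [Pi.sub_apply]; ring)
    · refine mul_le_mul_of_nonneg_right ?_ (hnn x)
      have h := Real.log_le_sub_one_of_pos (div_pos (Real.exp_pos (g x)) hmpos)
      rw [Real.log_div (Real.exp_pos _).ne' hmpos.ne', Real.log_exp] at h
      exact h
  have hL : ∫ x, (g x - Real.log m) * (Ω x * Ω x) ∂μ = ∫ x, g x * (Ω x * Ω x) ∂μ - Real.log m := by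
    have : (fun x => (g x - Real.log m) * (Ω x * Ω x)) = fun x => g x * (Ω x * Ω x) - Real.log m * (Ω x * Ω x) := by
      funext x; ring
    rw [this, integral_sub hgi (hΩ2.const_mul _), integral_const_mul, hΩ2one, mul_one]
  have hR : ∫ x, (Real.exp (g x) / m - 1) * (Ω x * Ω x) ∂μ = 0 := by
    have : (fun x => (Real.exp (g x) / m - 1) * (Ω x * Ω x)) =
        fun x => m⁻¹ * (Real.exp (g x) * (Ω x * Ω x)) - Ω x * Ω x := by
      funext x; rw [div_eq_mul_inv]; ring
    rw [this, integral_sub (hei.const_mul _) hΩ2, integral_const_mul, ← hm, inv_mul_cancel₀ hmpos.ne', hΩ2one, sub_self]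
  rw [hL, hR] at hkey
  linarith

/-- **`log ‖A‖ − log ‖B‖ ≤ ∫ (−2g) Ω²`** for the reweighting `w = e^{g}` (`g` bounded), `A ⪰ 0` self-adjoint with `0 < ‖A‖` and
unit top eigenvector `Ω`: the variational bound `‖A‖ (∫ e^{g} Ω²)² ≤ ‖B‖` followed by Jensen. [cite: ReedSimonIV1978, §XIII.12] -/
theorem log_norm_sub_log_norm_reweighted_le {g : X → ℝ} (hg : StronglyMeasurable g) {Cg : ℝ} (hCg : ∀ x, ‖g x‖ ≤ Cg)
    (hA : ∀ φ : Lp ℝ 2 μ, (A φ : X → ℝ) =ᵐ[μ] fun x => ∫ y, K x y * φ y ∂μ)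
    (hB : ∀ φ : Lp ℝ 2 μ, (B φ : X → ℝ) =ᵐ[μ] fun x => ∫ y, (Real.exp (g x) * K x y * Real.exp (g y)) * φ y ∂μ)
    (hAsa : IsSelfAdjoint A) (hApos : ∀ φ : Lp ℝ 2 μ, 0 ≤ ⟪φ, A φ⟫) (hA0 : 0 < ‖A‖) {Ω : Lp ℝ 2 μ} (h1 : ‖Ω‖ = 1)
    (heig : A Ω = ‖A‖ • Ω) :
    Real.log ‖A‖ - Real.log ‖B‖ ≤ ∫ x, (-2 * g x) * (Ω x * Ω x) ∂μ := by
  have hw : StronglyMeasurable fun x => Real.exp (g x) := Real.continuous_exp.comp_stronglyMeasurable hg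
  have hCw : ∀ x, ‖Real.exp (g x)‖ ≤ Real.exp Cg := fun x => by
    rw [Real.norm_eq_abs, abs_of_pos (Real.exp_pos _)]
    exact Real.exp_le_exp.2 ((le_abs_self _).trans ((Real.norm_eq_abs _).symm.le.trans (hCg x)))
  have hmain := norm_mul_sq_integral_le_norm_reweighted hw hCw hA hB hAsa hApos h1 heig
  have hJ := integral_mul_sq_le_log_integral_exp_mul_sq hg hCg h1 (μ := μ)
  set m : ℝ := ∫ x, Real.exp (g x) * (Ω x * Ω x) ∂μ with hm
  have hΩ2 : Integrable (fun x => Ω x * Ω x) μ := integrable_mul Ω Ω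
  have hΩ2one : ∫ x, Ω x * Ω x ∂μ = 1 := by
    rw [← inner_eq_integral, real_inner_self_eq_norm_sq, h1, one_pow]
  have hei : Integrable (fun x => Real.exp (g x) * (Ω x * Ω x)) μ := hΩ2.bdd_mul hw.aestronglyMeasurable (Eventually.of_forall hCw)
  have hmpos : 0 < m := by
    have hle : ∫ x, Real.exp (-Cg) * (Ω x * Ω x) ∂μ ≤ m := by
      refine integral_mono (hΩ2.const_mul _) hei fun x => ?_
      refine mul_le_mul_of_nonneg_right (Real.exp_le_exp.2 ?_) (mul_self_nonneg _)
      have := hCg x; rw [Real.norm_eq_abs] at this; linarith [neg_abs_le (g x)]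
    rw [integral_const_mul, hΩ2one, mul_one] at hle
    exact lt_of_lt_of_le (Real.exp_pos _) hle
  have hB0 : 0 < ‖B‖ := lt_of_lt_of_le (by positivity) hmain
  have hlog := Real.log_le_log (by positivity) hmain
  rw [Real.log_mul hA0.ne' (by positivity), Real.log_pow, Nat.cast_ofNat] at hlog
  have hgi : Integrable (fun x => g x * (Ω x * Ω x)) μ := hΩ2.bdd_mul hg.aestronglyMeasurable (Eventually.of_forall fun x => hCg x)
  have hneg : ∫ x, (-2 * g x) * (Ω x * Ω x) ∂μ = -2 * ∫ x, g x * (Ω x * Ω x) ∂μ := by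
    rw [← integral_const_mul]
    refine integral_congr_ae (Eventually.of_forall fun x => ?_); ring
  rw [hneg]
  linarith

end Reweight

/-! ### The rectangular tube: the sandwich -/

section Tube

variable {G : Type*} [Group G] [TopologicalSpace G] [IsTopologicalGroup G] [CompactSpace G]
  [MeasurableSpace G] [BorelSpace G] [SecondCountableTopology G] {n k : ℕ} (ρ : G →* Matrix (Fin n) (Fin n) ℂ)
  {J : ℝ} {Ls : Fin k → ℕ} [∀ i, NeZero (Ls i)]

/-- **Upper half of the sandwich**: if `B` has kernel `e^{g(a)} K(a,b) e^{g(b)}` (`g` continuous) and `Ω` is a unit top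
eigenvector of `T = rectTubeTransferOperator ρ J Ls` (`J ≥ 0`, continuous unitary `ρ`), then
`log ‖T‖ − log ‖B‖ ≤ ∫ (−2 g) Ω²`. [cite: ReedSimonIV1978, §XIII.12] [cite: Luscher1977] -/
theorem rectTube_log_norm_sub_reweighted_le (hρ : Continuous ρ) (hρu : ∀ g, ρ g ∈ Matrix.unitaryGroup (Fin n) ℂ)
    (hJ : 0 ≤ J) {g : RectSlice Ls G → ℝ} (hg : Continuous g)
    {B : Lp ℝ 2 (rectSliceMeasure G Ls) →L[ℝ] Lp ℝ 2 (rectSliceMeasure G Ls)}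
    (hB : ∀ φ, (B φ : RectSlice Ls G → ℝ) =ᵐ[rectSliceMeasure G Ls]
      fun a => ∫ b, (Real.exp (g a) * rectSliceKernel ρ J J a b * Real.exp (g b)) * φ b ∂(rectSliceMeasure G Ls))
    {Ω : Lp ℝ 2 (rectSliceMeasure G Ls)} (h1 : ‖Ω‖ = 1)
    (heig : rectTubeTransferOperator ρ J Ls Ω = ‖rectTubeTransferOperator ρ J Ls‖ • Ω) :
    Real.log ‖rectTubeTransferOperator ρ J Ls‖ - Real.log ‖B‖ ≤
      ∫ a, (-2 * g a) * (Ω a * Ω a) ∂(rectSliceMeasure G Ls) := by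
  obtain ⟨Cg, hCg⟩ := isCompact_univ.exists_bound_of_continuousOn hg.continuousOn
  exact log_norm_sub_log_norm_reweighted_le hg.stronglyMeasurable (fun x => hCg x (Set.mem_univ _))
    (rectTubeTransferOperator_ae_eq J Ls hρ) hB (isSelfAdjoint_rectTubeTransferOperator J Ls hρ hρu)
    (inner_rectTubeTransferOperator_self_nonneg ρ hρ hρu hJ) (norm_rectTubeTransferOperator_pos J Ls hρ) h1 heig

/-- **Lower half of the sandwich**: with `Ω'` a unit top eigenvector of the reweighted operator `B` (which is `⪰ 0` and has
`T` as ITS reweighting by `e^{−g}`), `∫ (−2 g) Ω'² ≤ log ‖T‖ − log ‖B‖`. [cite: ReedSimonIV1978, §XIII.12] [cite: Luscher1977] -/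
theorem rectTube_log_norm_sub_reweighted_ge (hρ : Continuous ρ) (hρu : ∀ g, ρ g ∈ Matrix.unitaryGroup (Fin n) ℂ)
    (hJ : 0 ≤ J) {g : RectSlice Ls G → ℝ} (hg : Continuous g)
    {B : Lp ℝ 2 (rectSliceMeasure G Ls) →L[ℝ] Lp ℝ 2 (rectSliceMeasure G Ls)}
    (hB : ∀ φ, (B φ : RectSlice Ls G → ℝ) =ᵐ[rectSliceMeasure G Ls]
      fun a => ∫ b, (Real.exp (g a) * rectSliceKernel ρ J J a b * Real.exp (g b)) * φ b ∂(rectSliceMeasure G Ls))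
    (hBsa : IsSelfAdjoint B) {Ω' : Lp ℝ 2 (rectSliceMeasure G Ls)} (h1 : ‖Ω'‖ = 1) (heig : B Ω' = ‖B‖ • Ω') :
    ∫ a, (-2 * g a) * (Ω' a * Ω' a) ∂(rectSliceMeasure G Ls) ≤
      Real.log ‖rectTubeTransferOperator ρ J Ls‖ - Real.log ‖B‖ := by
  obtain ⟨Cg, hCg⟩ := isCompact_univ.exists_bound_of_continuousOn hg.continuousOn
  have hCg' : ∀ x, ‖g x‖ ≤ Cg := fun x => hCg x (Set.mem_univ _)
  have hCng : ∀ x, ‖(-g) x‖ ≤ Cg := fun x => by rw [Pi.neg_apply, norm_neg]; exact hCg' x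
  have hw : StronglyMeasurable fun x => Real.exp (g x) := Real.continuous_exp.comp_stronglyMeasurable hg.stronglyMeasurable
  have hCw : ∀ x, ‖Real.exp (g x)‖ ≤ Real.exp Cg := fun x => by
    rw [Real.norm_eq_abs, abs_of_pos (Real.exp_pos _)]
    exact Real.exp_le_exp.2 ((le_abs_self _).trans ((Real.norm_eq_abs _).symm.le.trans (hCg' x)))
  -- `T` is the reweighting of `B` by `e^{−g}`
  have hT : ∀ φ, (rectTubeTransferOperator ρ J Ls φ : RectSlice Ls G → ℝ) =ᵐ[rectSliceMeasure G Ls]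
      fun a => ∫ b, (Real.exp ((-g) a) * (Real.exp (g a) * rectSliceKernel ρ J J a b * Real.exp (g b)) *
        Real.exp ((-g) b)) * φ b ∂(rectSliceMeasure G Ls) := by
    intro φ
    refine (rectTubeTransferOperator_ae_eq J Ls hρ φ).trans (Eventually.of_forall fun a => ?_)
    refine integral_congr_ae (Eventually.of_forall fun b => ?_)
    have h2 : Real.exp ((-g) a) * (Real.exp (g a) * rectSliceKernel ρ J J a b * Real.exp (g b)) * Real.exp ((-g) b) =
        rectSliceKernel ρ J J a b := by
      rw [Pi.neg_apply, Pi.neg_apply, Real.exp_neg, Real.exp_neg]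
      field_simp
    dsimp only
    rw [h2]
  -- `B ⪰ 0`, `0 < ‖B‖`
  have hBpos : ∀ φ : Lp ℝ 2 (rectSliceMeasure G Ls), 0 ≤ ⟪φ, B φ⟫ :=
    inner_reweighted_self_nonneg hw hCw (rectTubeTransferOperator_ae_eq J Ls hρ) hB
      (inner_rectTubeTransferOperator_self_nonneg ρ hρ hρu hJ)
  have hBK : StronglyMeasurable (uncurry fun a b => Real.exp (g a) * rectSliceKernel (Ls := Ls) ρ J J a b * Real.exp (g b)) :=
    ((((Real.continuous_exp.comp (hg.comp continuous_fst))).mul (continuous_rectSliceKernel ρ hρ J J)).mul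
      (Real.continuous_exp.comp (hg.comp continuous_snd))).stronglyMeasurable
  obtain ⟨C, hC⟩ := exists_rectSliceKernel_le (Ls := Ls) ρ hρ J J
  have hC0 : 0 ≤ C := (norm_nonneg _).trans (hC 1 1)
  have hBC : ∀ a b, ‖Real.exp (g a) * rectSliceKernel (Ls := Ls) ρ J J a b * Real.exp (g b)‖ ≤
      Real.exp Cg * C * Real.exp Cg := fun a b => by
    rw [norm_mul, norm_mul]
    exact mul_le_mul (mul_le_mul (hCw a) (hC a b) (norm_nonneg _) (Real.exp_pos _).le) (hCw b) (norm_nonneg _)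
      (mul_nonneg (Real.exp_pos _).le hC0)
  have hB0 : 0 < ‖B‖ := norm_pos_iff.2 (kernelOp_ne_zero hBK hBC
    (fun a b => mul_pos (mul_pos (Real.exp_pos _) (rectSliceKernel_pos ρ hρ J J a b)) (Real.exp_pos _))
    (IsProbabilityMeasure.ne_zero _) hB)
  have h := log_norm_sub_log_norm_reweighted_le (A := B) (B := rectTubeTransferOperator ρ J Ls) (g := -g)
    hg.neg.stronglyMeasurable hCng hB hT hBsa hBpos hB0 h1 heig
  have hneg : ∫ a, (-2 * (-g) a) * (Ω' a * Ω' a) ∂(rectSliceMeasure G Ls) =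
      -∫ a, (-2 * g a) * (Ω' a * Ω' a) ∂(rectSliceMeasure G Ls) := by
    rw [← integral_neg]
    refine integral_congr_ae (Eventually.of_forall fun a => ?_)
    simp only [Pi.neg_apply]; ring
  rw [hneg] at h
  linarith

end Tube

end Summit.Ventures.YMGap.FlowData
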